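import Mathlib
import Summits.CriticalPhenomena.CardyFormulaZ2.Theses.CardyRotToConf
import Summits.CriticalPhenomena.CardyFormulaZ2.Theorems.CardyRotToConfLimitGlue

/-!
# `CardyRotToConfThesisGlueR` — the glue step of route CardyRotToConf (repaired form)

Item stmt-CriticalPhenomena-17238 (support, rev ≥ 17). The REPAIRED crux r2R
`CardyRotToConfR2SymmetryUpgradeR` (symmetry upgrade for subsequential scaling limits of the ℤ²
interfaces, granted admissible discretisations of every Dobrushin domain), r3
`CardyRotToConfR3ScaleInvariance`, r4 `CardyRotToConfLimitFamily`, r5 `CardyRotToConfLoopRotation`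
together with the existence of admissible discretisations for every Dobrushin domain imply the route's
target `CardyRotToConfThesis`: convergence in law of the bond-ℤ² exploration interface at `p = 1/2` to
chordal SLE₆ for every Dobrushin domain and every admissible ℤ²-discretisation family.
Proof (pure logic plus one change of variables and one subsequence): `ZdDiscretisationFamily D E` and
`IsDiscretisation D E` have the same six fields (converted both ways); LimitFamily fed with
LoopRotation, the discretisations and R3 yields the chordal family `P` with
`bondInterfaceIn D (E δ) → P D` in law along `𝓝[>] 0`; composing with the meshes `δs n = 1/(n+1) → 0⁺`
(`tendsto_one_div_add_atTop_nhds_zero_nat`, `tendsto_nhdsWithin_iff`) gives the subsequential-limit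
clause (iv) of r2R, whence `IsSLELaw 6 D (P D)`; the landed limit glue `cardyRotToConfLimitGlue_proof`
(stmt-8602: convergence in law to `ν` + `IsSLELaw 6 D ν` ⇒ `ConvergesInLawToSLE`, by `integral_map`)
concludes, eventual a.e.-measurability being the first clause of R3 (Billingsley 1999 §1.2; Lawler
2005 §6.3).

History (dependency-drift repair 2026-08-17). The predecessor `CardyRotToConfThesisGlue`
(stmt-CriticalPhenomena-14585, proved here as `cardyRotToConfThesisGlue_proof`) had the ORIGINAL r2
`CardyRotToConfR2SymmetryUpgrade` as first antecedent; that crux was refuted-misstated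
(`Theorems.not_CardyRotToConfR2SymmetryUpgrade`, SLE₆ family vs its fat-germ one-shot surgery) and
route rev 17 (2026-08-16T23:03Z) dropped both decls, so the old theorem, stated against the dropped
decl by name, stopped elaborating (full build 2026-08-17). Theorems files being append-only, the old
name is kept as a DEPRECATED ALIAS of the repaired glue `cardyRotToConfThesisGlueR_proof`.
-/

namespace Summit.CriticalPhenomena.CardyFormulaZ2.Theorems

open MeasureTheory Filter Topology
open Literature.Probability.LatticeModels Literature.Probability.RandomPlanarGeometry

/-- **Thesis glue, repaired form** (item stmt-CriticalPhenomena-17238, route CardyRotToConf): the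
cruxes R2SymmetryUpgradeR, R3ScaleInvariance, LimitFamily, LoopRotation and the existence of
admissible discretisations of every Dobrushin domain imply the target `CardyRotToConfThesis`.
Convert between `ZdDiscretisationFamily` and `IsDiscretisation` (same fields), obtain the limit
chordal family `P` from LimitFamily, feed r2R with `P` as a subsequential limit along
`δs n = 1/(n+1)` to get `IsSLELaw 6 D (P D)`, and conclude by the limit glue
`cardyRotToConfLimitGlue_proof` (change of variables `integral_map`); eventual a.e.-measurability of
the interfaces is the first conjunct of R3. [cite: Lawler2005, §6.3] [cite: Billingsley1999, §1.2] -/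
theorem cardyRotToConfThesisGlueR_proof :
    Summit.CriticalPhenomena.CardyFormulaZ2.Theses.CardyRotToConf.CardyRotToConfThesisGlueR := by
  unfold Summit.CriticalPhenomena.CardyFormulaZ2.Theses.CardyRotToConf.CardyRotToConfThesisGlueR
  intro hR2 hR3 hLF hRot hDisc D E hE
  -- the two discretisation structures have the same six fields
  have toIsDisc : ∀ {D' : DobrushinDomain} {E' : ℝ → DiscreteDobrushin},
      ZdDiscretisationFamily D' E' → IsDiscretisation D' E' := fun h =>
    ⟨h.Ω_eq, h.δ_eq, h.tendsto_arcA, h.tendsto_arcB, h.tendsto_zdABEdges, h.eventually_isZdAdmissible⟩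
  have toZd : ∀ {D' : DobrushinDomain} {E' : ℝ → DiscreteDobrushin},
      IsDiscretisation D' E' → ZdDiscretisationFamily D' E' := fun h =>
    ⟨h.Ω_eq, h.δ_eq, h.tendsto_arcA, h.tendsto_arcB, h.tendsto_zdABEdges, h.eventually_isZdAdmissible⟩
  -- the limit chordal family
  obtain ⟨P, hP, hnt, hconv⟩ := hLF hRot hDisc hR3
  -- meshes `δs n = 1/(n+1) → 0⁺`
  have hδs : Tendsto (fun n : ℕ => 1 / ((n : ℝ) + 1)) atTop (𝓝[>] (0 : ℝ)) :=
    tendsto_nhdsWithin_iff.2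
      ⟨tendsto_one_div_add_atTop_nhds_zero_nat, Eventually.of_forall fun n => Set.mem_Ioi.2 (by positivity)⟩
  -- r2R: `P` is a subsequential scaling limit of the ℤ² interfaces, hence an SLE₆ law in every domain
  have hSLE : IsSLELaw 6 D (P D) :=
    hR2 (fun D₀ => (hDisc D₀).imp fun _ h => toZd h) P hP hnt
      ⟨fun n : ℕ => 1 / ((n : ℝ) + 1), fun n => by positivity, tendsto_one_div_add_atTop_nhds_zero_nat,
        fun D' E' hE' f => ((hconv D' E' (toIsDisc hE')) f).comp hδs⟩ D
  -- limit glue (stmt-8602): convergence in law to `P D` + SLE₆ law ⇒ convergence in law to SLE₆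
  exact cardyRotToConfLimitGlue_proof D _ (P D) (hR3 D E (toIsDisc hE)).1 (hconv D E (toIsDisc hE)) hSLE

/-- Deprecated spelling: **thesis glue, original form** (item stmt-CriticalPhenomena-14585, closed ·
proved by this name): its first antecedent, the original r2 `CardyRotToConfR2SymmetryUpgrade`, was
refuted-misstated and dropped from the route together with the glue decl at rev 17 (2026-08-16), so
the theorem stated against `…CardyRotToConf.CardyRotToConfThesisGlue` by name no longer elaborates; the
repaired glue on r2R is `cardyRotToConfThesisGlueR_proof`, of which the old name is kept as a deprecated
alias (Theorems files are append-only). -/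
@[deprecated cardyRotToConfThesisGlueR_proof (since := "2026-08-17")]
alias cardyRotToConfThesisGlue_proof := cardyRotToConfThesisGlueR_proof

end Summit.CriticalPhenomena.CardyFormulaZ2.Theorems
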